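import Summits.CriticalPhenomena.CardyFormulaZ2.Theorems.CardyMagicRigidityNestingRigidityHoelderToolkit
import HarnessLib

/-!
# Crux `NestingRigidity`: the UNTILTED route to `UVDecoupling` — the Hölder reduction (part 2 of 2)

Crux `Summit.CriticalPhenomena.CardyFormulaZ2.Theses.CardyMagicRigidity.NestingRigidity`
(stmt-CriticalPhenomena-4835), lines `positive-cone-weight-doubling` (skeleton r3, seat c4-0) and
`ring-cloud-tomography` (r6), shared stub R1' `stub_uvDecoupling : ∀ E ∈ latticeEnsembles, UVDecoupling E`.
Registered helper [C] `uvDecoupling_of_untilted_bounds` (this file, sorry-free): on both lattice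
ensembles `UVDecoupling E` follows from
* [A] UNTILTED exponential moments of all orders of the centred additive UV statistic
  `Θ + t·E_δ N` (`E_δ Θ = −t E_δ N` exactly, `integral_uvPhase_latticeEnsembles`, p126196) and of
  `Θ₂ = Σ θ_u²` (registered stub `uvExpMoments_latticeEnsembles`), and
* [B] a-priori POWER bounds `r^{C} ≤ E_δ[v^{N_0(r,1)}]` (`towerMoment_lower_latticeEnsembles`, LANDED
  p128174) and `E_δ[v^{N_0(r,1)}] ≤ r^{-C}` (`towerMoment_upper_latticeEnsembles`) at every base `v > 0`,
with NO tilted RSW statement (contrast `uvDecoupling_of_collar_bounds`, p126379, whose inputs (HK)/(U)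
are tilted bounds without slack).  `w = magicWeight t`, `N = N_0(r,1)`, `M(v) = E_δ[v^N]`, `p = 1+ε`,
`3Cε ≤ η/2`.  By the landed pathwise sandwich
`w^N e^{−√3Θ − Θ₂/cos(|t|+π/3)} ≤ A ≤ w^N e^{−√3Θ}` (`UVLinear.finprod_nestingFactor_mem_Icc`) and the
algebraic identity `−√3 Θ = √3 t m − √3 (Θ + t m)`:
* UPPER: `E[w^N e^{−√3U}] ≤ M(w^p)^{1/p} E[e^{−q√3 U}]^{1/q}` (Hölder, `q = p/ε`) and
  `M(w^p) ≤ M(w)^{1−ε} M(w²)^{ε}` (`towerMoment_interp`), so `M(w^p)^{1/p} ≤ r^{−3Cε} M(w)`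
  (`Hoelder.rpow_interp_upper`);
* LOWER: `M(w^{1/p}) ≤ E[w^N e^{Y}]^{1/p} E[e^{−Y/ε}]^{1/q}` (reverse Hölder, `Y = −√3U − Θ₂/c`),
  `E[e^{−Y/ε}] ≤ (E e^{(2√3/ε)U} + E e^{(2/cε)Θ₂})/2`, and
  `M(w) ≤ M(w^{1/p})^{(1+ε)/(1+2ε)} M(w²)^{ε/(1+2ε)}`, so `M(w^{1/p})^{p} ≥ r^{3Cε} M(w)`
  (`Hoelder.rpow_interp_lower`);
and for `r` small every constant is absorbed into `r^{±η/2}`.  No cited fact, no definition. -/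

noncomputable section

open MeasureTheory Set Filter Metric
open scoped Real Topology BigOperators ENNReal

namespace Summit.CriticalPhenomena.CardyFormulaZ2.Cruxes.NestingRigidity.PositiveConeWeightDoubling

open Literature.Probability.RandomPlanarGeometry Literature.Probability.Percolation
  Literature.Probability.LatticeModels
open Summit.CriticalPhenomena.CardyFormulaZ2.Cruxes.NestingRigidity.RingCloudTomography

namespace Hoelder

/-- Two-variable AM–GM for exponentials, in the form `2 e^{a+b} ≤ e^{2a} + e^{2b}`. -/
theorem two_mul_exp_add_le (a b : ℝ) : 2 * Real.exp (a + b) ≤ Real.exp (2 * a) + Real.exp (2 * b) := by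
  have ha : Real.exp (2 * a) = Real.exp a * Real.exp a := by rw [two_mul, Real.exp_add]
  have hb : Real.exp (2 * b) = Real.exp b * Real.exp b := by rw [two_mul, Real.exp_add]
  rw [Real.exp_add, ha, hb]
  nlinarith [sq_nonneg (Real.exp a - Real.exp b), Real.exp_pos a, Real.exp_pos b]

end Hoelder

open Hoelder in
/-- **[C] `UVDecoupling E` from UNTILTED bounds** (registered helper `uvDecoupling_of_untilted_bounds`,
seat c4-0; serves the shared stub R1' `stub_uvDecoupling` of lines `positive-cone-weight-doubling` /
`ring-cloud-tomography`).  Hypotheses: [A] for every charge `t` in the cone and every order `s > 0`,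
uniformly for small `r` and then small meshes, the exponential moments `E e^{±s(Θ + t·E N)}` and
`E e^{s Θ₂}` of the additive UV statistic `Θ = Σ_{u ∉ tower} θ_u` (centred by the exact identity
`E Θ = −t E N`) and of `Θ₂ = Σ θ_u²` are bounded; [B] a-priori power bounds `r^C ≤ E[v^{N_0(r,1)}]` and
`E[v^{N_0(r,1)}] ≤ r^{−C}` at every base `v > 0`.  Conclusion: `UVDecoupling E`.  Proof: module docstring
(Hölder / reverse Hölder in the tower weight with exponent `1 + ε`, `3Cε ≤ η/2`, interpolation between the
bases `w^{1/(1+ε)}`, `w`, `w^{1+ε}`, `w²`, and the landed pathwise UV sandwich). -/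
theorem uvDecoupling_of_untilted_bounds : ∀ E ∈ latticeEnsembles,
    (∀ t ∈ Set.Ioo (-(π / 6)) (π / 6), ∀ s : ℝ, 0 < s → ∃ C r₀ : ℝ, 0 < r₀ ∧ ∀ r ∈ Set.Ioo (0 : ℝ) r₀,
      ∀ᶠ δ in 𝓝[>] (0 : ℝ), ∀ Θ Θ₂ : E.Ω → ℝ,
        (∀ ω, Θ ω = ∑ᶠ u ∈ (E.X δ ω).loops \ {u ∈ (E.X δ ω).loops |
            Metric.closedBall (0 : ℂ) r ⊆ {z | u.wind z ≠ 0} ∧ u.range ⊆ Metric.ball (0 : ℂ) 1},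
            u.nestingPhase (coneCloud t r).density) →
        (∀ ω, Θ₂ ω = ∑ᶠ u ∈ (E.X δ ω).loops \ {u ∈ (E.X δ ω).loops |
            Metric.closedBall (0 : ℂ) r ⊆ {z | u.wind z ≠ 0} ∧ u.range ⊆ Metric.ball (0 : ℂ) 1},
            u.nestingPhase (coneCloud t r).density ^ 2) →
        Integrable (fun ω ↦ Real.exp (s * (Θ ω + t * meanTower E δ r))) E.P ∧
        ∫ ω, Real.exp (s * (Θ ω + t * meanTower E δ r)) ∂E.P ≤ C ∧
        Integrable (fun ω ↦ Real.exp (-(s * (Θ ω + t * meanTower E δ r)))) E.P ∧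
        ∫ ω, Real.exp (-(s * (Θ ω + t * meanTower E δ r))) ∂E.P ≤ C ∧
        Integrable (fun ω ↦ Real.exp (s * Θ₂ ω)) E.P ∧
        ∫ ω, Real.exp (s * Θ₂ ω) ∂E.P ≤ C) →
    (∀ w : ℝ, 0 < w → ∃ C r₀ : ℝ, 0 < r₀ ∧ ∀ r ∈ Set.Ioo (0 : ℝ) r₀, ∀ᶠ δ in 𝓝[>] (0 : ℝ),
      r ^ C ≤ E.towerMoment w δ r) →
    (∀ w : ℝ, 0 < w → ∃ C r₀ : ℝ, 0 < r₀ ∧ ∀ r ∈ Set.Ioo (0 : ℝ) r₀, ∀ᶠ δ in 𝓝[>] (0 : ℝ),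
      E.towerMoment w δ r ≤ r ^ (-C)) →
    UVDecoupling E := by
  intro E hE hA hBl hBu t ht η hη
  have htabs : |t| < π / 6 := abs_lt.2 ht
  have hw : 0 < magicWeight t := mul_pos two_pos (Real.cos_pos_of_mem_Ioo
    ⟨by linarith [ht.1, Real.pi_pos], by linarith [ht.2]⟩)
  set w := magicWeight t with hwdef
  set c : ℝ := Real.cos (|t| + π / 3) with hc
  have hcpos : 0 < c := Real.cos_pos_of_mem_Ioo ⟨by linarith [abs_nonneg t, Real.pi_pos], by linarith⟩
  have h3 : 0 < Real.sqrt 3 := Real.sqrt_pos.2 (by norm_num)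
  -- a-priori constants: lower bound at base `w`, upper bound at base `w²`
  obtain ⟨C₁, r₁, hr₁, hB₁⟩ := hBl w hw
  obtain ⟨C₂, r₂, hr₂, hB₂⟩ := hBu (w ^ 2) (pow_pos hw 2)
  set C : ℝ := max (max C₁ C₂) 1 with hCdef
  have hC1 : 1 ≤ C := le_max_right _ _
  have hC0 : 0 < C := by linarith
  have hCC₁ : C₁ ≤ C := (le_max_left _ _).trans (le_max_left _ _)
  have hCC₂ : C₂ ≤ C := (le_max_right _ _).trans (le_max_left _ _)
  -- the Hölder exponent `p = 1 + ε`
  set ε : ℝ := min (1 / 2) (η / (6 * C)) with hεdef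
  have hε : 0 < ε := lt_min (by norm_num) (div_pos hη (by positivity))
  have hε12 : ε ≤ 1 / 2 := min_le_left _ _
  have hε1 : ε ≤ 1 := by linarith
  have hεη : 3 * C * ε ≤ η / 2 := by
    have h : ε ≤ η / (6 * C) := min_le_right _ _
    rw [le_div_iff₀ (by positivity)] at h
    linarith
  have hp1 : 1 < 1 + ε := by linarith
  have hp0 : 0 < 1 + ε := by linarith
  have hpq : (1 + ε).HolderConjugate ((1 + ε) / ε) :=
    (Real.holderConjugate_iff_eq_conjExponent hp1).2 (by congr 1; ring)
  have hqinv : 1 / ((1 + ε) / ε) ≤ 1 := by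
    rw [div_le_one (by positivity), le_div_iff₀ hε, one_mul]; exact le_add_of_nonneg_left zero_le_one
  have hθ0 : 0 < 1 - ε := by linarith
  have hθ1 : 1 - ε < 1 := sub_lt_self 1 hε
  have hθ0' : 0 < (1 + ε) / (1 + 2 * ε) := by positivity
  have hθ1' : (1 + ε) / (1 + 2 * ε) < 1 := by rw [div_lt_one (by positivity)]; linarith
  have hexp' : 1 - (1 + ε) / (1 + 2 * ε) = ε / (1 + 2 * ε) := by field_simp; ring
  -- the four orders at which [A] is used
  obtain ⟨Cu, ru, hru, hAu⟩ := hA t ht (Real.sqrt 3 * (1 + ε) / ε) (by positivity)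
  obtain ⟨Ca, ra, hra, hAa⟩ := hA t ht (2 * Real.sqrt 3 / ε) (by positivity)
  obtain ⟨Cb, rb, hrb, hAb⟩ := hA t ht (2 / (c * ε)) (by positivity)
  obtain ⟨Cs, rs, hrs, hAs⟩ := hA t ht (Real.sqrt 3) h3
  -- the constant to absorb and the smallness of `r`
  set K : ℝ := max (max Cu ((Ca + Cb) / 2)) 1 with hKdef
  have hK1 : 1 ≤ K := le_max_right _ _
  have hK0 : 0 < K := by linarith
  have hKu : Cu ≤ K := (le_max_left _ _).trans (le_max_left _ _)
  have hKab : (Ca + Cb) / 2 ≤ K := (le_max_right _ _).trans (le_max_left _ _)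
  obtain ⟨rK, hrK, hsmall⟩ := exists_rpow_lt (half_pos hη) (inv_pos.2 hK0)
  refine ⟨min (min (min r₁ r₂) (min ru ra)) (min (min rb rs) (min rK (1 / 2))),
    lt_min (lt_min (lt_min hr₁ hr₂) (lt_min hru hra)) (lt_min (lt_min hrb hrs) (lt_min hrK one_half_pos)),
    fun r hr ↦ ?_⟩
  simp only [Set.mem_Ioo, lt_min_iff] at hr
  obtain ⟨hr0, ⟨⟨hrr₁, hrr₂⟩, hrru, hrra⟩, ⟨hrrb, hrrs⟩, hrrK, hrhalf⟩ := hr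
  have hr1 : r < 1 := hrhalf.trans one_half_lt_one
  have hr1' : r ≤ 1 := hr1.le
  -- the `r`-power bookkeeping, done once
  have hrpow_K : K ≤ r ^ (-(η / 2)) := by
    have h := hsmall r ⟨hr0, hrrK⟩
    rw [Real.rpow_neg hr0.le]
    rw [lt_inv_comm₀ (Real.rpow_pos_of_pos hr0 _) hK0] at h
    exact h.le
  have hrpow_up : r ^ (-(3 * C * ε)) * K ≤ r ^ (-η) := by
    calc r ^ (-(3 * C * ε)) * K ≤ r ^ (-(η / 2)) * r ^ (-(η / 2)) :=
          mul_le_mul (Real.rpow_le_rpow_of_exponent_ge hr0 hr1' (by linarith)) hrpow_K hK0.le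
            (Real.rpow_nonneg hr0.le _)
      _ = r ^ (-η) := by rw [← Real.rpow_add hr0]; congr 1; ring
  have hrpow_low : r ^ η * K ≤ r ^ (3 * C * ε) := by
    have h := hsmall r ⟨hr0, hrrK⟩
    have h' : r ^ (η / 2) * K < 1 := by
      calc r ^ (η / 2) * K < K⁻¹ * K := mul_lt_mul_of_pos_right h hK0
        _ = 1 := inv_mul_cancel₀ hK0.ne'
    calc r ^ η * K = r ^ (η / 2) * (r ^ (η / 2) * K) := by
          rw [← mul_assoc, ← Real.rpow_add hr0]; congr 1; ring
      _ ≤ r ^ (η / 2) * 1 := mul_le_mul_of_nonneg_left h'.le (Real.rpow_nonneg hr0.le _)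
      _ = r ^ (η / 2) := mul_one _
      _ ≤ r ^ (3 * C * ε) := Real.rpow_le_rpow_of_exponent_ge hr0 hr1' hεη
  filter_upwards [hB₁ r ⟨hr0, hrr₁⟩, hB₂ r ⟨hr0, hrr₂⟩, hAu r ⟨hr0, hrru⟩, hAa r ⟨hr0, hrra⟩,
    hAb r ⟨hr0, hrrb⟩, hAs r ⟨hr0, hrrs⟩, self_mem_nhdsWithin] with δ hδB₁ hδB₂ hδAu hδAa hδAb hδAs hδ
  rw [Set.mem_Ioi] at hδ
  haveI := isProbabilityMeasure_of_mem hE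
  -- the objects
  set T : E.Ω → Set (UnbasedLoop ℂ) := fun ω ↦ {u ∈ (E.X δ ω).loops |
    Metric.closedBall (0 : ℂ) r ⊆ {z | u.wind z ≠ 0} ∧ u.range ⊆ Metric.ball (0 : ℂ) 1} with hT
  set Θ : E.Ω → ℝ := fun ω ↦ ∑ᶠ u ∈ (E.X δ ω).loops \ T ω, u.nestingPhase (coneCloud t r).density
    with hΘ
  set Θ₂ : E.Ω → ℝ := fun ω ↦ ∑ᶠ u ∈ (E.X δ ω).loops \ T ω,
    u.nestingPhase (coneCloud t r).density ^ 2 with hΘ₂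
  set N : E.Ω → ℕ := fun ω ↦ towerCount (E.X δ ω) 0 r 1 with hN
  set m : ℝ := meanTower E δ r with hm
  set U : E.Ω → ℝ := fun ω ↦ Θ ω + t * m with hU
  set g : E.Ω → ℝ := fun ω ↦ w ^ N ω with hg
  set A : E.Ω → ℝ := fun ω ↦ (E.X δ ω).nestingWeight (coneCloud t r).density with hAdef
  set M : ℝ := E.towerMoment w δ r with hMdef
  set M₂ : ℝ := E.towerMoment (w ^ 2) δ r with hM₂def
  set Mp : ℝ := E.towerMoment (w ^ (1 + ε)) δ r with hMpdef
  set Mq : ℝ := E.towerMoment (w ^ (1 / (1 + ε))) δ r with hMqdef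
  -- instantiate [A] at the four orders
  obtain ⟨-, -, hIu, hbu, -, -⟩ := hδAu Θ Θ₂ (fun _ ↦ rfl) (fun _ ↦ rfl)
  obtain ⟨hIa, hba, -, -, -, -⟩ := hδAa Θ Θ₂ (fun _ ↦ rfl) (fun _ ↦ rfl)
  obtain ⟨-, -, -, -, hIb, hbb⟩ := hδAb Θ Θ₂ (fun _ ↦ rfl) (fun _ ↦ rfl)
  obtain ⟨-, -, hIs, -, -, -⟩ := hδAs Θ Θ₂ (fun _ ↦ rfl) (fun _ ↦ rfl)
  -- positivity / a-priori bounds of the four tower moments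
  have hMpos : 0 < M := towerMoment_pos_of_pos E hE hw hδ r
  have hM₂pos : 0 < M₂ := towerMoment_pos_of_pos E hE (pow_pos hw 2) hδ r
  have hMppos : 0 < Mp := towerMoment_pos_of_pos E hE (Real.rpow_pos_of_pos hw _) hδ r
  have hMqpos : 0 < Mq := towerMoment_pos_of_pos E hE (Real.rpow_pos_of_pos hw _) hδ r
  have hlow : r ^ C ≤ M := (Real.rpow_le_rpow_of_exponent_ge hr0 hr1' hCC₁).trans hδB₁
  have hup : M₂ ≤ r ^ (-C) := hδB₂.trans (Real.rpow_le_rpow_of_exponent_ge hr0 hr1' (neg_le_neg hCC₂))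
  -- measurability
  have hNm : Measurable N := measurable_towerCount E hE δ 0 r 1
  have hUm : AEMeasurable U E.P := by
    have h := (hIs.aestronglyMeasurable.aemeasurable.log).mul_const (-(Real.sqrt 3)⁻¹)
    refine h.congr (Eventually.of_forall fun ω ↦ ?_)
    simp only [Real.log_exp, hU]
    field_simp
  have hΘ₂m : AEMeasurable Θ₂ E.P := by
    have h := (hIb.aestronglyMeasurable.aemeasurable.log).mul_const (2 / (c * ε))⁻¹
    refine h.congr (Eventually.of_forall fun ω ↦ ?_)
    simp only [Real.log_exp]
    field_simp
  -- pathwise facts: bounded tower weight, factorisation, UV sandwich, `Θ₂ ≥ 0`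
  obtain ⟨Nmax, hNmax⟩ := ConeTilt.exists_towerCount_le E hE hδ 0 r 1
  set G : ℝ := max w 1 ^ Nmax with hGdef
  have hg0 : ∀ ω, 0 ≤ g ω := fun ω ↦ pow_nonneg hw.le _
  have hgG : ∀ ω, g ω ≤ G := fun ω ↦
    (pow_le_pow_left₀ hw.le (le_max_left w 1) _).trans
      (pow_le_pow_right₀ (le_max_right w 1) (hNmax ω))
  have hG0 : 0 ≤ G := pow_nonneg (hw.le.trans (le_max_left _ _)) _
  have hAfac : ∀ ω, A ω = g ω * ∏ᶠ u ∈ (E.X δ ω).loops \ T ω,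
      u.nestingFactor (coneCloud t r).density :=
    fun ω ↦ nestingWeight_coneCloud_eq_latticeEnsembles E hE hδ ω t hr0 hr1'
  have hUV := fun ω ↦ UVLinear.finprod_nestingFactor_mem_Icc E hE hδ ω htabs hr0 hr1' (T ω)
  have hAi : Integrable A E.P := UVLinear.integrable_nestingWeight_cone E hE hδ t hr0 hr1'
  have hΘ₂0 : ∀ ω, 0 ≤ Θ₂ ω := fun ω ↦ finsum_nonneg fun u ↦ finsum_nonneg fun _ ↦ sq_nonneg _
  -- the key algebraic identity `−√3 Θ = √3 t m − √3 U`
  have hΘU : ∀ ω, -(Real.sqrt 3 * Θ ω) = Real.sqrt 3 * t * m + -(Real.sqrt 3 * U ω) := by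
    intro ω; simp only [hU]; ring
  ------------------------------------------------------------------
  -- UPPER BOUND
  ------------------------------------------------------------------
  have hgm : AEStronglyMeasurable g E.P := (hNm.const_pow w).aestronglyMeasurable
  have hexpU : AEStronglyMeasurable (fun ω ↦ Real.exp (-(Real.sqrt 3 * U ω))) E.P :=
    hIs.aestronglyMeasurable
  -- integrability of `g · e^{−√3 U}` (bounded × integrable)
  have hInt_gU : Integrable (fun ω ↦ g ω * Real.exp (-(Real.sqrt 3 * U ω))) E.P :=
    Integrable.mono' (hIs.const_mul G) (hgm.mul hexpU) (Eventually.of_forall fun ω ↦ by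
      rw [Real.norm_of_nonneg (mul_nonneg (hg0 ω) (Real.exp_nonneg _))]
      exact mul_le_mul_of_nonneg_right (hgG ω) (Real.exp_nonneg _))
  -- (1) `∫ A ≤ e^{√3 t m} ∫ g e^{−√3 U}`
  have hUp1 : ∫ ω, A ω ∂E.P ≤
      Real.exp (Real.sqrt 3 * t * m) * ∫ ω, g ω * Real.exp (-(Real.sqrt 3 * U ω)) ∂E.P := by
    rw [← integral_const_mul]
    refine integral_mono hAi ((hInt_gU).const_mul _) fun ω ↦ ?_
    rw [hAfac ω]
    calc g ω * ∏ᶠ u ∈ (E.X δ ω).loops \ T ω, u.nestingFactor (coneCloud t r).density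
        ≤ g ω * Real.exp (-(Real.sqrt 3 * Θ ω)) := mul_le_mul_of_nonneg_left (hUV ω).2 (hg0 ω)
      _ = Real.exp (Real.sqrt 3 * t * m) * (g ω * Real.exp (-(Real.sqrt 3 * U ω))) := by
          rw [hΘU ω, Real.exp_add]; ring
  -- (2) Hölder with exponents `1 + ε`, `(1+ε)/ε`
  have hpow_g : ∀ ω, g ω ^ (1 + ε) = (w ^ (1 + ε)) ^ N ω := fun ω ↦ (rpow_pow_comm' hw.le _ _).symm
  have hpow_e : ∀ ω, Real.exp (-(Real.sqrt 3 * U ω)) ^ ((1 + ε) / ε) =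
      Real.exp (-(Real.sqrt 3 * (1 + ε) / ε * (Θ ω + t * m))) := fun ω ↦ by
    rw [← Real.exp_mul]; congr 1; simp only [hU]; ring
  have hUp2 : ∫ ω, g ω * Real.exp (-(Real.sqrt 3 * U ω)) ∂E.P ≤ Mp ^ (1 / (1 + ε)) * K := by
    have hH := holder_of_integrable_rpow (μ := E.P) hpq hg0 (fun ω ↦ Real.exp_nonneg _) hgm hexpU
      ((ConeTilt.integrable_pow_towerCount_of_nonneg E hE _ hδ 0 r 1
        (Real.rpow_nonneg hw.le _)).congr (Eventually.of_forall fun ω ↦ (hpow_g ω).symm))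
      (hIu.congr (Eventually.of_forall fun ω ↦ (hpow_e ω).symm))
    have e1 : ∫ ω, g ω ^ (1 + ε) ∂E.P = Mp := by
      simp only [hMpdef, LoopEnsemble.towerMoment]
      exact integral_congr_ae (Eventually.of_forall hpow_g)
    have e2 : ∫ ω, Real.exp (-(Real.sqrt 3 * U ω)) ^ ((1 + ε) / ε) ∂E.P ≤ K :=
      (integral_congr_ae (Eventually.of_forall hpow_e)).trans_le (hbu.trans hKu)
    rw [e1] at hH
    refine hH.trans (mul_le_mul_of_nonneg_left ?_ (Real.rpow_nonneg hMppos.le _))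
    exact rpow_le_of_le_of_one_le (integral_nonneg fun ω ↦ Real.rpow_nonneg (Real.exp_nonneg _) _)
      e2 hK1 (by positivity) hqinv
  -- (3) interpolation between the bases `w`, `w²`
  have hUp3 : Mp ^ (1 / (1 + ε)) ≤ r ^ (-(3 * C * ε)) * M := by
    have hI := towerMoment_interp E hE hδ r hw (pow_pos hw 2) hθ0 hθ1
    have hbase : w ^ (1 - ε) * (w ^ 2) ^ (1 - (1 - ε)) = w ^ (1 + ε) := by
      rw [sub_sub_cancel, show ((w ^ 2 : ℝ)) = w ^ (2 : ℝ) by norm_cast, ← Real.rpow_mul hw.le,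
        ← Real.rpow_add hw]; congr 1; ring
    rw [hbase, sub_sub_cancel] at hI
    exact rpow_interp_upper hr0 hr1 hC0.le hε hMpos hM₂pos hMppos hlow hup hI
  -- assemble the upper bound
  have hUpper : ∫ ω, A ω ∂E.P ≤ r ^ (-η) * (M * Real.exp (Real.sqrt 3 * t * m)) := by
    have hexp0 : 0 < Real.exp (Real.sqrt 3 * t * m) := Real.exp_pos _
    calc ∫ ω, A ω ∂E.P ≤ Real.exp (Real.sqrt 3 * t * m) * (Mp ^ (1 / (1 + ε)) * K) :=
          hUp1.trans (mul_le_mul_of_nonneg_left hUp2 hexp0.le)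
      _ ≤ Real.exp (Real.sqrt 3 * t * m) * (r ^ (-(3 * C * ε)) * M * K) :=
          mul_le_mul_of_nonneg_left (mul_le_mul_of_nonneg_right hUp3 hK0.le) hexp0.le
      _ = (r ^ (-(3 * C * ε)) * K) * (M * Real.exp (Real.sqrt 3 * t * m)) := by ring
      _ ≤ r ^ (-η) * (M * Real.exp (Real.sqrt 3 * t * m)) :=
          mul_le_mul_of_nonneg_right hrpow_up (mul_nonneg hMpos.le hexp0.le)
  ------------------------------------------------------------------
  -- LOWER BOUND
  ------------------------------------------------------------------
  -- `Y' = −√3 U − Θ₂ / c`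
  set Y : E.Ω → ℝ := fun ω ↦ -(Real.sqrt 3 * U ω) - Θ₂ ω / c with hY
  have hYm : AEMeasurable Y E.P := (hUm.const_mul _).neg.sub (hΘ₂m.div_const _)
  have hYle : ∀ ω, Y ω ≤ -(Real.sqrt 3 * U ω) := fun ω ↦
    sub_le_self _ (div_nonneg (hΘ₂0 ω) hcpos.le)
  -- integrability of `I = ∫ g e^{Y}` (dominated by `G e^{−√3 U}`)
  have hgYm : AEStronglyMeasurable (fun ω ↦ g ω * Real.exp (Y ω)) E.P :=
    (hgm.aemeasurable.mul hYm.exp).aestronglyMeasurable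
  have hInt_gY : Integrable (fun ω ↦ g ω * Real.exp (Y ω)) E.P :=
    Integrable.mono' (hIs.const_mul G) hgYm (Eventually.of_forall fun ω ↦ by
      rw [Real.norm_of_nonneg (mul_nonneg (hg0 ω) (Real.exp_nonneg _))]
      exact mul_le_mul (hgG ω) (Real.exp_le_exp.2 (hYle ω)) (Real.exp_nonneg _) hG0)
  set I : ℝ := ∫ ω, g ω * Real.exp (Y ω) ∂E.P with hIdef
  have hI0 : 0 ≤ I := integral_nonneg fun ω ↦ mul_nonneg (hg0 ω) (Real.exp_nonneg _)
  -- (1') `e^{√3 t m} I ≤ ∫ A`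
  have hLo1 : Real.exp (Real.sqrt 3 * t * m) * I ≤ ∫ ω, A ω ∂E.P := by
    rw [hIdef, ← integral_const_mul]
    refine integral_mono (hInt_gY.const_mul _) hAi fun ω ↦ ?_
    rw [hAfac ω]
    calc Real.exp (Real.sqrt 3 * t * m) * (g ω * Real.exp (Y ω))
        = g ω * Real.exp (-(Real.sqrt 3 * Θ ω) - Θ₂ ω / Real.cos (|t| + π / 3)) := by
          rw [hΘU ω, show Real.sqrt 3 * t * m + -(Real.sqrt 3 * U ω) - Θ₂ ω / Real.cos (|t| + π / 3)
            = Real.sqrt 3 * t * m + Y ω by simp only [hY, hc]; ring, Real.exp_add]; ring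
      _ ≤ g ω * ∏ᶠ u ∈ (E.X δ ω).loops \ T ω, u.nestingFactor (coneCloud t r).density :=
          mul_le_mul_of_nonneg_left (hUV ω).1 (hg0 ω)
  -- (2') reverse Hölder: `Mq ≤ I^{1/p} D^{1/q}` with `D = ∫ e^{−Y/ε} ≤ K`
  set v : ℝ := w ^ (1 / (1 + ε)) with hv
  have hv0 : 0 < v := Real.rpow_pos_of_pos hw _
  have hvp : v ^ (1 + ε) = w := by
    rw [hv, ← Real.rpow_mul hw.le, one_div_mul_cancel hp0.ne', Real.rpow_one]
  set f₁ : E.Ω → ℝ := fun ω ↦ v ^ N ω * Real.exp (Y ω / (1 + ε)) with hf₁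
  set f₂ : E.Ω → ℝ := fun ω ↦ Real.exp (-(Y ω / (1 + ε))) with hf₂
  have hf₁0 : ∀ ω, 0 ≤ f₁ ω := fun ω ↦ mul_nonneg (pow_nonneg hv0.le _) (Real.exp_nonneg _)
  have hf₂0 : ∀ ω, 0 ≤ f₂ ω := fun ω ↦ Real.exp_nonneg _
  have hf₁m : AEStronglyMeasurable f₁ E.P :=
    ((hNm.const_pow v).aemeasurable.mul (hYm.div_const _).exp).aestronglyMeasurable
  have hf₂m : AEStronglyMeasurable f₂ E.P := (hYm.div_const _).neg.exp.aestronglyMeasurable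
  have hprod : ∀ ω, f₁ ω * f₂ ω = v ^ N ω := fun ω ↦ by
    simp only [hf₁, hf₂]; rw [mul_assoc, ← Real.exp_add, add_neg_cancel, Real.exp_zero, mul_one]
  have hf₁p : ∀ ω, f₁ ω ^ (1 + ε) = g ω * Real.exp (Y ω) := fun ω ↦ by
    simp only [hf₁, hg]
    rw [Real.mul_rpow (pow_nonneg hv0.le _) (Real.exp_nonneg _), ← rpow_pow_comm' hv0.le, hvp,
      ← Real.exp_mul, div_mul_cancel₀ _ hp0.ne']
  have hf₂q : ∀ ω, f₂ ω ^ ((1 + ε) / ε) =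
      Real.exp (Real.sqrt 3 / ε * U ω + Θ₂ ω / (c * ε)) := fun ω ↦ by
    simp only [hf₂, hY]; rw [← Real.exp_mul]; congr 1; field_simp; ring
  -- the dominating pair for `D`
  have hDom : ∀ ω, Real.exp (Real.sqrt 3 / ε * U ω + Θ₂ ω / (c * ε)) ≤
      (Real.exp (2 * Real.sqrt 3 / ε * (Θ ω + t * m)) + Real.exp (2 / (c * ε) * Θ₂ ω)) / 2 :=
    fun ω ↦ by
      have h : Real.exp (Real.sqrt 3 / ε * U ω + Θ₂ ω / (c * ε)) ≤
          (Real.exp (2 * (Real.sqrt 3 / ε * U ω)) + Real.exp (2 * (Θ₂ ω / (c * ε)))) / 2 := by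
        rw [le_div_iff₀ two_pos, mul_comm]
        exact two_mul_exp_add_le _ _
      rwa [show 2 * (Real.sqrt 3 / ε * U ω) = 2 * Real.sqrt 3 / ε * (Θ ω + t * m) by
          simp only [hU]; ring,
        show 2 * (Θ₂ ω / (c * ε)) = 2 / (c * ε) * Θ₂ ω by ring] at h
  have hIntD : Integrable (fun ω ↦ f₂ ω ^ ((1 + ε) / ε)) E.P := by
    refine Integrable.mono' ((hIa.add hIb).div_const 2)
      ((hf₂m.aemeasurable.pow_const _).aestronglyMeasurable) (Eventually.of_forall fun ω ↦ ?_)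
    rw [Real.norm_of_nonneg (Real.rpow_nonneg (hf₂0 ω) _), hf₂q ω]
    exact hDom ω
  have hD_le : ∫ ω, f₂ ω ^ ((1 + ε) / ε) ∂E.P ≤ K := by
    calc ∫ ω, f₂ ω ^ ((1 + ε) / ε) ∂E.P
        ≤ ∫ ω, (Real.exp (2 * Real.sqrt 3 / ε * (Θ ω + t * m)) + Real.exp (2 / (c * ε) * Θ₂ ω)) / 2
            ∂E.P := integral_mono hIntD ((hIa.add hIb).div_const 2) fun ω ↦ (hf₂q ω).le.trans (hDom ω)
      _ = ((∫ ω, Real.exp (2 * Real.sqrt 3 / ε * (Θ ω + t * m)) ∂E.P) +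
            ∫ ω, Real.exp (2 / (c * ε) * Θ₂ ω) ∂E.P) / 2 := by
          rw [integral_div, integral_add hIa hIb]
      _ ≤ (Ca + Cb) / 2 := by gcongr
      _ ≤ K := hKab
  have hD0 : 0 ≤ ∫ ω, f₂ ω ^ ((1 + ε) / ε) ∂E.P :=
    integral_nonneg fun ω ↦ Real.rpow_nonneg (hf₂0 ω) _
  have hLo2 : Mq ≤ I ^ (1 / (1 + ε)) * (∫ ω, f₂ ω ^ ((1 + ε) / ε) ∂E.P) ^ (1 / ((1 + ε) / ε)) := by
    have hH := holder_of_integrable_rpow (μ := E.P) hpq hf₁0 hf₂0 hf₁m hf₂m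
      (hInt_gY.congr (Eventually.of_forall fun ω ↦ (hf₁p ω).symm)) hIntD
    have e0 : ∫ ω, f₁ ω * f₂ ω ∂E.P = Mq := by
      simp only [hMqdef, LoopEnsemble.towerMoment]
      exact integral_congr_ae (Eventually.of_forall hprod)
    have e1 : ∫ ω, f₁ ω ^ (1 + ε) ∂E.P = I := integral_congr_ae (Eventually.of_forall hf₁p)
    rwa [e0, e1] at hH
  -- (3') `Mq^{1+ε} ≤ I · D^{ε} ≤ I · K`
  have hLo3 : Mq ^ (1 + ε) ≤ I * K := by
    have h1 : Mq ^ (1 + ε) ≤ (I ^ (1 / (1 + ε)) *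
        (∫ ω, f₂ ω ^ ((1 + ε) / ε) ∂E.P) ^ (1 / ((1 + ε) / ε))) ^ (1 + ε) :=
      Real.rpow_le_rpow hMqpos.le hLo2 hp0.le
    rw [Real.mul_rpow (Real.rpow_nonneg hI0 _) (Real.rpow_nonneg hD0 _), ← Real.rpow_mul hI0,
      one_div_mul_cancel hp0.ne', Real.rpow_one, ← Real.rpow_mul hD0] at h1
    refine h1.trans (mul_le_mul_of_nonneg_left ?_ hI0)
    have hexp : 1 / ((1 + ε) / ε) * (1 + ε) = ε := by field_simp
    rw [hexp]
    exact rpow_le_of_le_of_one_le hD0 hD_le hK1 hε.le hε1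
  -- (4') interpolation between the bases `w^{1/p}`, `w²`
  have hLo4 : r ^ (3 * C * ε) * M ≤ Mq ^ (1 + ε) := by
    have hI' := towerMoment_interp E hE hδ r hv0 (pow_pos hw 2) hθ0' hθ1'
    have hbase : v ^ ((1 + ε) / (1 + 2 * ε)) * (w ^ 2) ^ (1 - (1 + ε) / (1 + 2 * ε)) = w := by
      rw [hv, show ((w ^ 2 : ℝ)) = w ^ (2 : ℝ) by norm_cast, ← Real.rpow_mul hw.le,
        ← Real.rpow_mul hw.le, ← Real.rpow_add hw]
      conv_rhs => rw [← Real.rpow_one w]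
      congr 1; field_simp; ring
    rw [hbase, hexp'] at hI'
    exact rpow_interp_lower hr0 hε hMpos hM₂pos hMqpos hlow hup hI'
  -- assemble the lower bound
  have hLower : r ^ η * (M * Real.exp (Real.sqrt 3 * t * m)) ≤ ∫ ω, A ω ∂E.P := by
    have hexp0 : 0 < Real.exp (Real.sqrt 3 * t * m) := Real.exp_pos _
    have hIK : r ^ η * M ≤ I := by
      -- `r^η K M ≤ r^{3Cε} M ≤ Mq^p ≤ I K`
      have h := (mul_le_mul_of_nonneg_right hrpow_low hMpos.le).trans (hLo4.trans hLo3)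
      rw [mul_right_comm] at h
      exact le_of_mul_le_mul_right h hK0
    calc r ^ η * (M * Real.exp (Real.sqrt 3 * t * m)) = Real.exp (Real.sqrt 3 * t * m) * (r ^ η * M) := by
          ring
      _ ≤ Real.exp (Real.sqrt 3 * t * m) * I := mul_le_mul_of_nonneg_left hIK hexp0.le
      _ ≤ ∫ ω, A ω ∂E.P := hLo1
  exact ⟨hLower, hUpper⟩

end Summit.CriticalPhenomena.CardyFormulaZ2.Cruxes.NestingRigidity.PositiveConeWeightDoubling

end
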